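import Literature.Barriers.CriticalPhenomena.GridSAWFormulaTilesB
import Literature.Barriers.CriticalPhenomena.GridSAWFormulaTilesC
import Literature.Barriers.CriticalPhenomena.GridSAWGridFormulaGraphExplicit
import Literature.Barriers.CriticalPhenomena.GridSAWOuterReturns
import Literature.Barriers.CriticalPhenomena.GridSAWTiledDrawingSub
import HarnessLib

/-!
# The tiling of the grid drawing of the graph of a formula: kinds, placements, names, returns

The layout of the grid drawing `E₀` of `Literature.Combinatorics.SimpleGraph.GridFormula.graphOf ψ`
(Liśkiewicz–Ogihara–Toda 2003, Lemma 4 / Theorem 7; tree fact `GridSAW.LOT2003_lemma4_gadgets`),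
assembled (`assembleOn`, `GridSAWTiledDrawingOn.lean`) from the tiles of
`GridSAWFormulaTiles{A,B,C}.lean` and completed by the outer returns of `GridSAWOuterReturns.lean`:

* `Kind` — the twenty tile kinds, with `Kind.tile`, `Kind.roles`, `Kind.validW`;
* the LAYOUT: the `V × N` matrix of tiles `(i, j)` (row `i` = variable, column `j` = literal
  occurrence) at origin `(72 j, -54 (i + 1))`, every row running west to east; the clause-row
  column tiles at `(72 j, -54 V - 40)`; the rung tiles of the three-literal clauses at
  `(72 · cstart q, -54 V - 48)`; kinds `mKind`, `cKind` (first / middle / last column, tile type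
  `tileTy`, the doubling cell inside tile `(0, 0)`, landing slot and clause width for the columns);
* the NAMES: `mName`, `cName`, `rName` send the role of a local vertex (`TileRole`) to the vertex
  of `graphOf ψ` it draws (`17 k`, `17 k + 1 + b`, `gbase g + code`); the placements `matrixP`,
  `clauseP`, `rungP`, `placements`; positions `gposOf` (first placement listing the name);
* the RETURNS `returns ψ`: the chain edge from the east end of row `i` (exit corner of its last
  cell, drawn on the east side `x = 72 N`) to the connector starting row `i + 1` (on the west side
  `x = 0`), the last one into the clause row, with margins `V - i`;
* the BODY `body ψ`: the drawing on the vertex list `vertsListOf ψ` whose edge list IS the edge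
  list `edgesOf ψ` of the graph minus the return edges, each edge drawn by the path of the placed
  tile edge with the same ends (`lookupPath`; `GridSAWTiledDrawingSub.lean`), and **`drawing ψ`**
  (body plus returns) — so that the drawn graph is `graphOf ψ` by construction
  (`drawing_ends_iff`).

The hypotheses of `assembleSub_isValid` / `ReturnsOK` and the machine are the sequels.

## References

* M. Liśkiewicz, M. Ogihara, S. Toda, TCS 304 (2003) 129–156, §3 (proof of Lemma 4), §4 (proof
  of Theorem 7: the grid embedding `E₀`).
-/

namespace Literature.Barriers.CriticalPhenomena.GridSAW

namespace FormulaTiles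

open Literature.Computability.Complexity (CNF)
open Literature.Combinatorics.SimpleGraph Literature.Combinatorics.SimpleGraph.GridFormula
open Literature.Combinatorics.SimpleGraph.GridFormula.Slot
open Literature.Combinatorics.SimpleGraph.GridCell (CellTy conn vtx)
open GridFormulaFP (vertsListOf edgesOf)

/-! ### The tile kinds -/

/-- **The twenty tile kinds**: matrix tiles by type (`empty`/`tap`/`cross`) and column position
(first / middle / last), the first tile of row `0` with the doubling cell (also as the only tile),
clause-row column tiles by landing slot (`bN3`/`bN0`), clause width (one / three literals) and
position (not last / last), and the rung tile of a three-literal clause. [folklore] -/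
inductive Kind
  | emptyFirst
  | emptyMid
  | emptyLast
  | tapFirst
  | tapMid
  | tapLast
  | crossFirst
  | crossMid
  | crossLast
  | tapDoubler
  | tapDoublerLast
  | clauseBn3Or1Notlast
  | clauseBn3Or1Last
  | clauseBn3Or3Notlast
  | clauseBn3Or3Last
  | clauseBn0Or1Notlast
  | clauseBn0Or1Last
  | clauseBn0Or3Notlast
  | clauseBn0Or3Last
  | rung3
  deriving DecidableEq, Repr

namespace Kind

/-- The tile of a kind. [folklore] -/
def tile : Kind → Tile
  | .emptyFirst => emptyFirstT
  | .emptyMid => emptyMidT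
  | .emptyLast => emptyLastT
  | .tapFirst => tapFirstT
  | .tapMid => tapMidT
  | .tapLast => tapLastT
  | .crossFirst => crossFirstT
  | .crossMid => crossMidT
  | .crossLast => crossLastT
  | .tapDoubler => tapDoublerT
  | .tapDoublerLast => tapDoublerLastT
  | .clauseBn3Or1Notlast => clauseBn3Or1NotlastT
  | .clauseBn3Or1Last => clauseBn3Or1LastT
  | .clauseBn3Or3Notlast => clauseBn3Or3NotlastT
  | .clauseBn3Or3Last => clauseBn3Or3LastT
  | .clauseBn0Or1Notlast => clauseBn0Or1NotlastT
  | .clauseBn0Or1Last => clauseBn0Or1LastT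
  | .clauseBn0Or3Notlast => clauseBn0Or3NotlastT
  | .clauseBn0Or3Last => clauseBn0Or3LastT
  | .rung3 => rung3T

/-- The roles of the local vertices of a kind. [folklore] -/
def roles : Kind → List TileRole
  | .emptyFirst => emptyFirstTRoles
  | .emptyMid => emptyMidTRoles
  | .emptyLast => emptyLastTRoles
  | .tapFirst => tapFirstTRoles
  | .tapMid => tapMidTRoles
  | .tapLast => tapLastTRoles
  | .crossFirst => crossFirstTRoles
  | .crossMid => crossMidTRoles
  | .crossLast => crossLastTRoles
  | .tapDoubler => tapDoublerTRoles
  | .tapDoublerLast => tapDoublerLastTRoles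
  | .clauseBn3Or1Notlast => clauseBn3Or1NotlastTRoles
  | .clauseBn3Or1Last => clauseBn3Or1LastTRoles
  | .clauseBn3Or3Notlast => clauseBn3Or3NotlastTRoles
  | .clauseBn3Or3Last => clauseBn3Or3LastTRoles
  | .clauseBn0Or1Notlast => clauseBn0Or1NotlastTRoles
  | .clauseBn0Or1Last => clauseBn0Or1LastTRoles
  | .clauseBn0Or3Notlast => clauseBn0Or3NotlastTRoles
  | .clauseBn0Or3Last => clauseBn0Or3LastTRoles
  | .rung3 => rung3TRoles

/-- **Every kind's tile is weakly valid** (the kernel computations of the tile files). [folklore] -/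
theorem validW : ∀ k : Kind, k.tile.ValidW
  | .emptyFirst => emptyFirstT_validW
  | .emptyMid => emptyMidT_validW
  | .emptyLast => emptyLastT_validW
  | .tapFirst => tapFirstT_validW
  | .tapMid => tapMidT_validW
  | .tapLast => tapLastT_validW
  | .crossFirst => crossFirstT_validW
  | .crossMid => crossMidT_validW
  | .crossLast => crossLastT_validW
  | .tapDoubler => tapDoublerT_validW
  | .tapDoublerLast => tapDoublerLastT_validW
  | .clauseBn3Or1Notlast => clauseBn3Or1NotlastT_validW
  | .clauseBn3Or1Last => clauseBn3Or1LastT_validW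
  | .clauseBn3Or3Notlast => clauseBn3Or3NotlastT_validW
  | .clauseBn3Or3Last => clauseBn3Or3LastT_validW
  | .clauseBn0Or1Notlast => clauseBn0Or1NotlastT_validW
  | .clauseBn0Or1Last => clauseBn0Or1LastT_validW
  | .clauseBn0Or3Notlast => clauseBn0Or3NotlastT_validW
  | .clauseBn0Or3Last => clauseBn0Or3LastT_validW
  | .rung3 => rung3T_validW

/-- Every kind has one role per local vertex. [folklore] -/
theorem roles_length : ∀ k : Kind, k.roles.length = k.tile.nv
  | .emptyFirst => emptyFirstTRoles_length
  | .emptyMid => emptyMidTRoles_length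
  | .emptyLast => emptyLastTRoles_length
  | .tapFirst => tapFirstTRoles_length
  | .tapMid => tapMidTRoles_length
  | .tapLast => tapLastTRoles_length
  | .crossFirst => crossFirstTRoles_length
  | .crossMid => crossMidTRoles_length
  | .crossLast => crossLastTRoles_length
  | .tapDoubler => tapDoublerTRoles_length
  | .tapDoublerLast => tapDoublerLastTRoles_length
  | .clauseBn3Or1Notlast => clauseBn3Or1NotlastTRoles_length
  | .clauseBn3Or1Last => clauseBn3Or1LastTRoles_length
  | .clauseBn3Or3Notlast => clauseBn3Or3NotlastTRoles_length
  | .clauseBn3Or3Last => clauseBn3Or3LastTRoles_length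
  | .clauseBn0Or1Notlast => clauseBn0Or1NotlastTRoles_length
  | .clauseBn0Or1Last => clauseBn0Or1LastTRoles_length
  | .clauseBn0Or3Notlast => clauseBn0Or3NotlastTRoles_length
  | .clauseBn0Or3Last => clauseBn0Or3LastTRoles_length
  | .rung3 => rung3TRoles_length

/-- The role of local vertex `idx` (default `.s` beyond the end). [folklore] -/
def role (k : Kind) (idx : ℕ) : TileRole := k.roles.getD idx .s

end Kind

/-! ### The layout: kinds of the matrix and clause-row tiles -/

/-- Column position of a tile. [folklore] -/
inductive ColPos
  | first
  | mid
  | last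
  deriving DecidableEq, Repr

/-- The matrix kind of a tile type at a column position. [folklore] -/
def matrixKindOf : TileTy → ColPos → Kind
  | .empty, .first => .emptyFirst
  | .empty, .mid => .emptyMid
  | .empty, .last => .emptyLast
  | .tap, .first => .tapFirst
  | .tap, .mid => .tapMid
  | .tap, .last => .tapLast
  | .cross, .first => .crossFirst
  | .cross, .mid => .crossMid
  | .cross, .last => .crossLast

variable (ψ : CNF ℕ)

/-- The column position of column `j` (`first` takes precedence only when `N ≥ 2`; with `N = 1`
the only column is both, handled by the doubler kinds and the `last` clause kinds). [folklore] -/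
def colPos (j : ℕ) : ColPos := if j + 1 = N ψ then .last else if j = 0 then .first else .mid

/-- **The kind of matrix tile `(i, j)`**: the doubler kinds at `(0, 0)`, otherwise by type and
column position. [folklore] -/
def mKind (i j : ℕ) : Kind :=
  if i = 0 ∧ j = 0 then (if N ψ = 1 then .tapDoublerLast else .tapDoubler)
  else matrixKindOf (tileTy ψ i j) (colPos ψ j)

/-- The clause of column `j` has one literal. [folklore] -/
def isUnitCol (j : ℕ) : Bool := decide ((ψ.map List.length).getD (colClause ψ j) 0 = 1)

/-- **The kind of the clause-row column tile `j`**: by landing slot, clause width, position. [folklore] -/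
def cKind (j : ℕ) : Kind :=
  if landSlot ψ j = bN3 then
    (if isUnitCol ψ j then (if j + 1 = N ψ then .clauseBn3Or1Last else .clauseBn3Or1Notlast)
     else (if j + 1 = N ψ then .clauseBn3Or3Last else .clauseBn3Or3Notlast))
  else
    (if isUnitCol ψ j then (if j + 1 = N ψ then .clauseBn0Or1Last else .clauseBn0Or1Notlast)
     else (if j + 1 = N ψ then .clauseBn0Or3Last else .clauseBn0Or3Notlast))

/-! ### The names of the roles -/

/-- **The vertex of `graphOf ψ` drawn by a role in matrix tile `(i, j)`.** [folklore] -/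
def mName (i j : ℕ) : TileRole → ℕ
  | .cell c b => 17 * tileCell ψ i j c + 1 + b
  | .conn c => 17 * tileCell ψ i j c
  | .gad r code => gbase ψ (8 * (i * N ψ + j) + r) + code
  | .gadNext0 code => gbase ψ (8 * (i * N ψ + j + 1)) + code
  | .gadCo code => gbase ψ (colOwner ψ i j) + code
  | .dcell b => 1 + b
  | _ => 0

/-- The gadget index of the OR-gadget of the clause of column `j`. [folklore] -/
def orGadOf (j : ℕ) : ℕ := 8 * (V ψ * N ψ) + N ψ + colClause ψ j

/-- The position of column `j` inside its clause. [folklore] -/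
def colInClause (j : ℕ) : ℕ := j - cstart ψ (colClause ψ j)

/-- **The vertex of `graphOf ψ` drawn by a role in the clause-row column tile `j`.** [folklore] -/
def cName (j : ℕ) : TileRole → ℕ
  | .bead b => 17 * clauseBead ψ j + 1 + b
  | .bconn => 17 * clauseBead ψ j
  | .bconnN => 17 * clauseBead ψ (j + 1)
  | .land code => gbase ψ (8 * (V ψ * N ψ) + j) + code
  | .orr i => gbase ψ (orGadOf ψ j) + (if isUnitCol ψ j then i else 6 * colInClause ψ j + i)
  | .orm => gbase ψ (orGadOf ψ j) + (if isUnitCol ψ j then 2 else 18 + colInClause ψ j)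
  | _ => 0

/-- **The vertex of `graphOf ψ` drawn by a role in the rung tile of clause `q`.** [folklore] -/
def rName (q : ℕ) : TileRole → ℕ
  | .or code => gbase ψ (8 * (V ψ * N ψ) + N ψ + q) + code
  | _ => 0

/-! ### The placements -/

/-- The height of a matrix tile, the height of a clause-row column tile, the height of a rung tile,
the common width. [folklore] -/
def HM : ℕ := 54
/-- The height of a clause-row column tile. [folklore] -/
def HC : ℕ := 40
/-- The height of a rung tile. [folklore] -/
def HR : ℕ := 8
/-- The width of a matrix / clause-row column tile. [folklore] -/
def WT : ℕ := 72

/-- **The placement of matrix tile `(i, j)`.** [folklore] -/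
def matrixP (i j : ℕ) : Placement where
  T := (mKind ψ i j).tile
  o := ((WT * j : ℕ), -((HM * (i + 1) : ℕ) : ℤ))
  ν := fun idx => mName ψ i j ((mKind ψ i j).role idx)

/-- The `y`-coordinate of the bottom of the clause-row column tiles. [folklore] -/
def yClause : ℤ := -((HM * V ψ + HC : ℕ) : ℤ)

/-- **The placement of the clause-row column tile `j`.** [folklore] -/
def clauseP (j : ℕ) : Placement where
  T := (cKind ψ j).tile
  o := ((WT * j : ℕ), yClause ψ)
  ν := fun idx => cName ψ j ((cKind ψ j).role idx)

/-- **The placement of the rung tile of clause `q`.** [folklore] -/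
def rungP (q : ℕ) : Placement where
  T := rung3T
  o := ((WT * cstart ψ q : ℕ), yClause ψ - HR)
  ν := fun idx => rName ψ q (Kind.rung3.role idx)

/-- The three-literal clauses. [folklore] -/
def rungClauses : List ℕ := (List.range ψ.length).filter fun q => (ψ.map List.length).getD q 0 = 3

/-- **All placements**: the matrix row by row, the clause-row columns, the rung tiles. [folklore] -/
def placements : List Placement :=
  ((List.range (V ψ)).flatMap fun i => (List.range (N ψ)).map fun j => matrixP ψ i j) ++
    ((List.range (N ψ)).map (clauseP ψ) ++ (rungClauses ψ).map (rungP ψ))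

/-- The named positions of a placement: `(ν i, o + pos i)` for its local vertices. [folklore] -/
def namedPos (P : Placement) : List (ℕ × GridPoint) :=
  (List.range P.T.nv).map fun i => (P.ν i, P.shift (P.T.pos.getD i (0, 0)))

/-- **The position of a vertex**: the position given by the first placement listing it (junk `(0,0)`
for an unlisted name). [folklore] -/
def gposOf (v : ℕ) : GridPoint :=
  (((placements ψ).flatMap namedPos).find? fun np => np.1 = v).elim (0, 0) Prod.snd

/-- **The path drawing the edge `{a, b}`**: the path of the first placed tile edge with these ends,
oriented from `a` to `b` (empty if there is none). [folklore] -/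
def lookupPath (L : List Placement) (a b : ℕ) : List GridPoint :=
  ((L.flatMap Placement.gedges).find? fun d => (d.1 = a ∧ d.2.1 = b) ∨ (d.1 = b ∧ d.2.1 = a)).elim []
    fun d => if d.1 = a then d.2.2 else d.2.2.reverse

/-! ### The returns -/

/-- The `y`-coordinate below everything (bottom of the rung tiles). [folklore] -/
def yS : ℤ := yClause ψ - HR

/-- **The return of row `i`**: from the exit corner of the last cell of row `i` (on the east side,
at height `26` of the row) to the connector of the first cell of row `i + 1` (on the west side, at
height `14`), the last one (`i = V - 1`) into the connector of the first clause-row terminal;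
margin `V - i`. [folklore] -/
def returnOf (i : ℕ) : SDrawing.Return ℕ :=
  (17 * tileCell ψ i (N ψ - 1) 2 + 1 + 3,
    (if i + 1 < V ψ then 17 * tileCell ψ (i + 1) 0 0 else 17 * clauseBead ψ 0),
    V ψ - i,
    -((HM * (i + 1) : ℕ) : ℤ) + 26,
    (if i + 1 < V ψ then -((HM * (i + 2) : ℕ) : ℤ) + 14 else yClause ψ + 14))

/-- **The returns.** [folklore] -/
def returns : List (SDrawing.Return ℕ) := (List.range (V ψ)).map (returnOf ψ)

/-- The end pairs of the returns (these chain edges are drawn around the body, not by tiles). [folklore] -/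
def returnPairs : List (ℕ × ℕ) := (returns ψ).map fun r => (r.1, r.2.1)

/-- **The edges of the body**: the edges of `graphOf ψ` other than the returns, each drawn by the
looked-up tile path. [folklore] -/
def bodyEdges : List (SEdge ℕ) :=
  ((edgesOf ψ).filter fun e => decide (e ∉ returnPairs ψ ∧ e.swap ∉ returnPairs ψ)).map
    fun e => (e.1, e.2, lookupPath (placements ψ) e.1 e.2)

/-- **The body of the drawing**: the vertex list of `graphOf ψ`, the positions, the body edges. [folklore] -/
def body : SDrawing ℕ := ⟨vertsListOf ψ, gposOf ψ, bodyEdges ψ⟩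

/-- **The grid drawing of the graph of `ψ`**: the body and the returns around it.
[cite: LiskiewiczOgiharaToda2003, §4 (proof of Theorem 7, E₀)] -/
def drawing : SDrawing ℕ :=
  (body ψ).addEdges ((returns ψ).map (SDrawing.Return.edge 0 ((WT * N ψ : ℕ) : ℤ) (yS ψ)))

/-! ### First facts -/

/-- Every placed tile is weakly valid. [folklore] -/
theorem placements_validW : ∀ P ∈ placements ψ, P.T.ValidW := by
  intro P hP
  unfold placements at hP
  simp only [List.mem_append, List.mem_flatMap, List.mem_map, List.mem_range] at hP
  rcases hP with ⟨i, -, j, -, rfl⟩ | ⟨j, -, rfl⟩ | ⟨q, -, rfl⟩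
  · exact Kind.validW _
  · exact Kind.validW _
  · exact Kind.validW .rung3

/-- The vertices of the drawing are the vertex list of `graphOf ψ`. [folklore] -/
theorem drawing_verts : (drawing ψ).verts = vertsListOf ψ := rfl

/-- The positions of the drawing. [folklore] -/
theorem drawing_pos : (drawing ψ).pos = gposOf ψ := rfl

end FormulaTiles

end Literature.Barriers.CriticalPhenomena.GridSAW

/-!
# The tiling of the grid drawing of the graph of a formula, II: the lattice geometry

The boxes of the placements of `GridSAWFormulaTiling.lean` (the grid drawing `E₀` of
`GridFormula.graphOf ψ`; Liśkiewicz–Ogihara–Toda 2003, Lemma 4 / Theorem 7, tree fact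
`GridSAW.LOT2003_lemma4_gadgets`) form a lattice: matrix tile `(i, j)` occupies
`[72 j, 72 j + 72] × [-54 (i+1), -54 i]`, clause-row column `j` occupies `[72 j, 72 j + 72] × [y_C, y_C + 40]`
(`y_C = -54 V - 40`), the rung tile of a three-literal clause `q` occupies
`[72 · cstart q, 72 · cstart q + 216] × [y_C - 8, y_C]`. This file proves the purely geometric
hypothesis `boxes` of the assembly (`TilingHypsGeo.boxes`, `GridSAWTiledDrawingSub.lean`): two
distinct placed boxes meet only along their boundaries, and there the lower / eastern one is on its
restricted (top / left) side; and records the dimensions of the kinds and the box / boundary /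
restricted-side predicates of the three placement families in coordinates.

## References

* M. Liśkiewicz, M. Ogihara, S. Toda, TCS 304 (2003) 129–156, §4 (proof of Theorem 7, `E₀`).
-/

namespace Literature.Barriers.CriticalPhenomena.GridSAW

/-! ### Boundary and restricted sides of a placement in coordinates -/

/-- The boundary of a placed tile, in coordinates. [folklore] -/
theorem Placement.bdry_iff (P : Placement) {q : GridPoint} :
    P.Bdry q ↔ q.1 = P.o.1 ∨ q.1 = P.o.1 + P.T.w ∨ q.2 = P.o.2 ∨ q.2 = P.o.2 + P.T.h := by
  unfold Placement.Bdry Tile.OnBdry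
  simp only
  omega

/-- The restricted sides of a placed non-mirrored tile, in coordinates. [folklore] -/
theorem Placement.restrG_iff (P : Placement) (hm : P.T.mirrored = false) {q : GridPoint} :
    P.RestrG q ↔ q.2 = P.o.2 + P.T.h ∨ q.1 = P.o.1 := by
  unfold Placement.RestrG Tile.Restr
  rw [hm]
  simp only [Bool.false_eq_true, ↓reduceIte]
  omega

namespace FormulaTiles

open Literature.Computability.Complexity (CNF)
open Literature.Combinatorics.SimpleGraph Literature.Combinatorics.SimpleGraph.GridFormula

/-! ### Dimensions of the kinds -/

namespace Kind

/-- Matrix kinds. [folklore] -/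
def isMatrix : Kind → Bool
  | .emptyFirst | .emptyMid | .emptyLast | .tapFirst | .tapMid | .tapLast | .crossFirst | .crossMid | .crossLast
  | .tapDoubler | .tapDoublerLast => true
  | _ => false

/-- Clause-row column kinds. [folklore] -/
def isClause : Kind → Bool
  | .clauseBn3Or1Notlast | .clauseBn3Or1Last | .clauseBn3Or3Notlast | .clauseBn3Or3Last
  | .clauseBn0Or1Notlast | .clauseBn0Or1Last | .clauseBn0Or3Notlast | .clauseBn0Or3Last => true
  | _ => false

/-- **Dimensions**: matrix tiles are `72 × 54`, clause-row column tiles `72 × 40`, the rung tile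
`216 × 8`; no tile is mirrored. [folklore] -/
theorem dims : ∀ K : Kind,
    K.tile.w = (if K = .rung3 then 216 else 72) ∧ K.tile.h = (if K.isMatrix then 54 else if K.isClause then 40 else 8) ∧
      K.tile.mirrored = false
  | .emptyFirst => ⟨rfl, rfl, rfl⟩
  | .emptyMid => ⟨rfl, rfl, rfl⟩
  | .emptyLast => ⟨rfl, rfl, rfl⟩
  | .tapFirst => ⟨rfl, rfl, rfl⟩
  | .tapMid => ⟨rfl, rfl, rfl⟩
  | .tapLast => ⟨rfl, rfl, rfl⟩
  | .crossFirst => ⟨rfl, rfl, rfl⟩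
  | .crossMid => ⟨rfl, rfl, rfl⟩
  | .crossLast => ⟨rfl, rfl, rfl⟩
  | .tapDoubler => ⟨rfl, rfl, rfl⟩
  | .tapDoublerLast => ⟨rfl, rfl, rfl⟩
  | .clauseBn3Or1Notlast => ⟨rfl, rfl, rfl⟩
  | .clauseBn3Or1Last => ⟨rfl, rfl, rfl⟩
  | .clauseBn3Or3Notlast => ⟨rfl, rfl, rfl⟩
  | .clauseBn3Or3Last => ⟨rfl, rfl, rfl⟩
  | .clauseBn0Or1Notlast => ⟨rfl, rfl, rfl⟩
  | .clauseBn0Or1Last => ⟨rfl, rfl, rfl⟩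
  | .clauseBn0Or3Notlast => ⟨rfl, rfl, rfl⟩
  | .clauseBn0Or3Last => ⟨rfl, rfl, rfl⟩
  | .rung3 => ⟨rfl, rfl, rfl⟩

end Kind

variable (ψ : CNF ℕ)

/-- Matrix kinds are matrix kinds. [folklore] -/
theorem mKind_isMatrix (i j : ℕ) : (mKind ψ i j).isMatrix = true := by
  unfold mKind
  split_ifs
  · rfl
  · rfl
  · cases tileTy ψ i j <;> cases colPos ψ j <;> rfl

/-- Clause kinds are clause kinds. [folklore] -/
theorem cKind_isClause (j : ℕ) : (cKind ψ j).isClause = true := by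
  unfold cKind
  split_ifs <;> rfl

/-- A matrix kind is not the rung kind. [folklore] -/
theorem Kind.ne_rung_of_isMatrix {K : Kind} (h : K.isMatrix = true) : K ≠ .rung3 := by
  rintro rfl; exact Bool.false_ne_true h

/-- A clause kind is not the rung kind and not a matrix kind. [folklore] -/
theorem Kind.ne_rung_of_isClause {K : Kind} (h : K.isClause = true) : K ≠ .rung3 ∧ K.isMatrix = false := by
  cases K <;> simp [Kind.isClause, Kind.isMatrix] at h ⊢

/-- **Dimensions of a matrix placement.** [folklore] -/
theorem matrixP_dims (i j : ℕ) :
    (matrixP ψ i j).T.w = 72 ∧ (matrixP ψ i j).T.h = 54 ∧ (matrixP ψ i j).T.mirrored = false ∧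
      (matrixP ψ i j).o = (((72 * j : ℕ) : ℤ), -((54 * (i + 1) : ℕ) : ℤ)) := by
  obtain ⟨hw, hh, hm⟩ := Kind.dims (mKind ψ i j)
  have hM := mKind_isMatrix ψ i j
  rw [if_neg (Kind.ne_rung_of_isMatrix hM)] at hw
  rw [hM] at hh
  exact ⟨hw, hh, hm, rfl⟩

/-- **Dimensions of a clause-row column placement.** [folklore] -/
theorem clauseP_dims (j : ℕ) :
    (clauseP ψ j).T.w = 72 ∧ (clauseP ψ j).T.h = 40 ∧ (clauseP ψ j).T.mirrored = false ∧
      (clauseP ψ j).o = (((72 * j : ℕ) : ℤ), yClause ψ) := by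
  obtain ⟨hw, hh, hm⟩ := Kind.dims (cKind ψ j)
  obtain ⟨hne, hM⟩ := Kind.ne_rung_of_isClause (cKind_isClause ψ j)
  rw [if_neg hne] at hw
  rw [hM, cKind_isClause] at hh
  exact ⟨hw, hh, hm, rfl⟩

/-- **Dimensions of a rung placement.** [folklore] -/
theorem rungP_dims (q : ℕ) :
    (rungP ψ q).T.w = 216 ∧ (rungP ψ q).T.h = 8 ∧ (rungP ψ q).T.mirrored = false ∧
      (rungP ψ q).o = (((72 * cstart ψ q : ℕ) : ℤ), yClause ψ - 8) :=
  ⟨rfl, rfl, rfl, rfl⟩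

/-- `yClause = -54 V - 40`. [folklore] -/
theorem yClause_eq : yClause ψ = -((54 * V ψ + 40 : ℕ) : ℤ) := rfl

/-! ### Members of the placement list -/

/-- The three families of placements. [folklore] -/
theorem mem_placements_iff {P : Placement} :
    P ∈ placements ψ ↔ (∃ i < V ψ, ∃ j < N ψ, P = matrixP ψ i j) ∨ (∃ j < N ψ, P = clauseP ψ j) ∨
      (∃ q ∈ rungClauses ψ, P = rungP ψ q) := by
  unfold placements
  simp only [List.mem_append, List.mem_flatMap, List.mem_map, List.mem_range]
  constructor
  · rintro (⟨i, hi, j, hj, rfl⟩ | ⟨j, hj, rfl⟩ | ⟨q, hq, rfl⟩)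
    · exact Or.inl ⟨i, hi, j, hj, rfl⟩
    · exact Or.inr (Or.inl ⟨j, hj, rfl⟩)
    · exact Or.inr (Or.inr ⟨q, hq, rfl⟩)
  · rintro (⟨i, hi, j, hj, rfl⟩ | ⟨j, hj, rfl⟩ | ⟨q, hq, rfl⟩)
    · exact Or.inl ⟨i, hi, j, hj, rfl⟩
    · exact Or.inr (Or.inl ⟨j, hj, rfl⟩)
    · exact Or.inr (Or.inr ⟨q, hq, rfl⟩)

/-- Rung clauses are three-literal clauses of `ψ`. [folklore] -/
theorem mem_rungClauses_iff {q : ℕ} : q ∈ rungClauses ψ ↔ q < ψ.length ∧ (ψ.map List.length).getD q 0 = 3 := by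
  unfold rungClauses; simp

/-- Clause widths through `getD` (local copy of `GridFormulaFP.getD_map_length`). [folklore] -/
theorem getD_map_length' {q : ℕ} (hq : q < ψ.length) : (ψ.map List.length).getD q 0 = ψ[q].length := by
  rw [List.getD_eq_getElem _ _ (by simpa using hq)]
  simp

/-- The first columns of distinct three-literal clauses are three apart. [folklore] -/
theorem cstart_apart {q q' : ℕ} (hq : q ∈ rungClauses ψ) (_hq' : q' ∈ rungClauses ψ) (hlt : q < q') :
    cstart ψ q + 3 ≤ cstart ψ q' := by
  obtain ⟨hql, hw⟩ := (mem_rungClauses_iff ψ).1 hq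
  rw [getD_map_length' ψ hql] at hw
  have h1 := cstart_succ ψ hql
  have h2 := cstart_mono ψ (show q + 1 ≤ q' from hlt)
  omega

/-! ### The hypothesis `boxes` -/

/-- Coordinates of the box, the boundary and the restricted sides of a placement with known
dimensions. [folklore] -/
theorem box_bdry_restr {P : Placement} {w h : ℕ} {ox oy : ℤ} (hw : P.T.w = w) (hh : P.T.h = h) (hm : P.T.mirrored = false)
    (ho : P.o = (ox, oy)) (q : GridPoint) :
    (P.Box q ↔ ox ≤ q.1 ∧ q.1 ≤ ox + w ∧ oy ≤ q.2 ∧ q.2 ≤ oy + h) ∧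
      (P.Bdry q ↔ q.1 = ox ∨ q.1 = ox + w ∨ q.2 = oy ∨ q.2 = oy + h) ∧
        (P.RestrG q ↔ q.2 = oy + h ∨ q.1 = ox) := by
  rw [Placement.box_iff, P.bdry_iff, P.restrG_iff hm, hw, hh, ho]
  exact ⟨Iff.rfl, Iff.rfl, Iff.rfl⟩

/-- **Distinct placed boxes meet only along their boundaries, where the lower / eastern one is on its
restricted side.** [folklore] -/
theorem placements_boxes : ∀ P ∈ placements ψ, ∀ Q ∈ placements ψ, P ≠ Q → ∀ q, P.Box q → Q.Box q →
    (P.Bdry q ∧ Q.Bdry q) ∧ (P.RestrG q ∨ Q.RestrG q) := by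
  intro P hP Q hQ hPQ q hqP hqQ
  -- coordinates of both placements
  have keyM : ∀ {i j : ℕ} (q : GridPoint), ((matrixP ψ i j).Box q ↔ (72 * j : ℤ) ≤ q.1 ∧ q.1 ≤ 72 * j + 72 ∧
      -(54 * (i + 1) : ℤ) ≤ q.2 ∧ q.2 ≤ -(54 * (i + 1) : ℤ) + 54) ∧
      ((matrixP ψ i j).Bdry q ↔ q.1 = 72 * j ∨ q.1 = 72 * j + 72 ∨ q.2 = -(54 * (i + 1) : ℤ) ∨ q.2 = -(54 * (i + 1) : ℤ) + 54) ∧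
      ((matrixP ψ i j).RestrG q ↔ q.2 = -(54 * (i + 1) : ℤ) + 54 ∨ q.1 = 72 * j) := by
    intro i j q
    obtain ⟨hw, hh, hm, ho⟩ := matrixP_dims ψ i j
    have := box_bdry_restr hw hh hm ho q
    push_cast at this ⊢
    exact this
  have keyC : ∀ {j : ℕ} (q : GridPoint), ((clauseP ψ j).Box q ↔ (72 * j : ℤ) ≤ q.1 ∧ q.1 ≤ 72 * j + 72 ∧
      yClause ψ ≤ q.2 ∧ q.2 ≤ yClause ψ + 40) ∧
      ((clauseP ψ j).Bdry q ↔ q.1 = 72 * j ∨ q.1 = 72 * j + 72 ∨ q.2 = yClause ψ ∨ q.2 = yClause ψ + 40) ∧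
      ((clauseP ψ j).RestrG q ↔ q.2 = yClause ψ + 40 ∨ q.1 = 72 * j) := by
    intro j q
    obtain ⟨hw, hh, hm, ho⟩ := clauseP_dims ψ j
    have := box_bdry_restr hw hh hm ho q
    push_cast at this ⊢
    exact this
  have keyR : ∀ {r : ℕ} (q : GridPoint), ((rungP ψ r).Box q ↔ (72 * cstart ψ r : ℤ) ≤ q.1 ∧ q.1 ≤ 72 * cstart ψ r + 216 ∧
      yClause ψ - 8 ≤ q.2 ∧ q.2 ≤ yClause ψ - 8 + 8) ∧
      ((rungP ψ r).Bdry q ↔ q.1 = 72 * cstart ψ r ∨ q.1 = 72 * cstart ψ r + 216 ∨ q.2 = yClause ψ - 8 ∨ q.2 = yClause ψ - 8 + 8) ∧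
      ((rungP ψ r).RestrG q ↔ q.2 = yClause ψ - 8 + 8 ∨ q.1 = 72 * cstart ψ r) := by
    intro r q
    obtain ⟨hw, hh, hm, ho⟩ := rungP_dims ψ r
    have := box_bdry_restr hw hh hm ho q
    push_cast at this ⊢
    exact this
  have hyC := yClause_eq ψ
  rcases (mem_placements_iff ψ).1 hP with ⟨i, hi, j, hj, rfl⟩ | ⟨j, hj, rfl⟩ | ⟨r, hr, rfl⟩ <;>
    rcases (mem_placements_iff ψ).1 hQ with ⟨i', hi', j', hj', rfl⟩ | ⟨j', hj', rfl⟩ | ⟨r', hr', rfl⟩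
  · -- matrix / matrix
    obtain ⟨hb, hd, hs⟩ := keyM (i := i) (j := j) q
    obtain ⟨hb', hd', hs'⟩ := keyM (i := i') (j := j') q
    rw [hb] at hqP; rw [hb'] at hqQ; rw [hd, hd', hs, hs']
    have hne : ¬ (i = i' ∧ j = j') := by rintro ⟨rfl, rfl⟩; exact hPQ rfl
    constructor
    · constructor <;> omega
    · omega
  · -- matrix / clause
    obtain ⟨hb, hd, hs⟩ := keyM (i := i) (j := j) q
    obtain ⟨hb', hd', hs'⟩ := keyC (j := j') q
    rw [hb] at hqP; rw [hb'] at hqQ; rw [hd, hd', hs, hs']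
    rw [hyC] at hqQ ⊢
    push_cast at hqQ ⊢
    constructor
    · constructor <;> omega
    · omega
  · -- matrix / rung: disjoint
    obtain ⟨hb, -, -⟩ := keyM (i := i) (j := j) q
    obtain ⟨hb', -, -⟩ := keyR (r := r') q
    rw [hb] at hqP; rw [hb'] at hqQ
    rw [hyC] at hqQ; push_cast at hqQ
    exfalso; omega
  · -- clause / matrix
    obtain ⟨hb, hd, hs⟩ := keyC (j := j) q
    obtain ⟨hb', hd', hs'⟩ := keyM (i := i') (j := j') q
    rw [hb] at hqP; rw [hb'] at hqQ; rw [hd, hd', hs, hs']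
    rw [hyC] at hqP ⊢
    push_cast at hqP ⊢
    constructor
    · constructor <;> omega
    · omega
  · -- clause / clause
    obtain ⟨hb, hd, hs⟩ := keyC (j := j) q
    obtain ⟨hb', hd', hs'⟩ := keyC (j := j') q
    rw [hb] at hqP; rw [hb'] at hqQ; rw [hd, hd', hs, hs']
    have hne : j ≠ j' := by rintro rfl; exact hPQ rfl
    constructor
    · constructor <;> omega
    · omega
  · -- clause / rung
    obtain ⟨hb, hd, hs⟩ := keyC (j := j) q
    obtain ⟨hb', hd', hs'⟩ := keyR (r := r') q
    rw [hb] at hqP; rw [hb'] at hqQ; rw [hd, hd', hs, hs']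
    constructor
    · constructor <;> omega
    · omega
  · -- rung / matrix: disjoint
    obtain ⟨hb, -, -⟩ := keyR (r := r) q
    obtain ⟨hb', -, -⟩ := keyM (i := i') (j := j') q
    rw [hb] at hqP; rw [hb'] at hqQ
    rw [hyC] at hqP; push_cast at hqP
    exfalso; omega
  · -- rung / clause
    obtain ⟨hb, hd, hs⟩ := keyR (r := r) q
    obtain ⟨hb', hd', hs'⟩ := keyC (j := j') q
    rw [hb] at hqP; rw [hb'] at hqQ; rw [hd, hd', hs, hs']
    constructor
    · constructor <;> omega
    · omega
  · -- rung / rung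
    obtain ⟨hb, hd, hs⟩ := keyR (r := r) q
    obtain ⟨hb', hd', hs'⟩ := keyR (r := r') q
    rw [hb] at hqP; rw [hb'] at hqQ; rw [hd, hd', hs, hs']
    have hne : r ≠ r' := by rintro rfl; exact hPQ rfl
    rcases Nat.lt_or_gt_of_ne hne with hlt | hlt
    · have := cstart_apart ψ hr hr' hlt
      constructor
      · constructor <;> omega
      · omega
    · have := cstart_apart ψ hr' hr hlt
      constructor
      · constructor <;> omega
      · omega

end FormulaTiles

end Literature.Barriers.CriticalPhenomena.GridSAW

/-!
# The tiling of the grid drawing of the graph of a formula, III: the finite facts about the kinds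

Everything the parametric proofs about the drawing `E₀` of `GridFormula.graphOf ψ`
(`GridSAWFormulaTiling.lean`; Liśkiewicz–Ogihara–Toda 2003, Lemma 4 / Theorem 7, tree fact
`GridSAW.LOT2003_lemma4_gadgets`) need to know about the twenty tile LITERALS is collected here as
ONE decidable predicate per kind, certified by `decide`, and unpacked into usable lemmas:

* classifiers `Kind.isFirstCol`, `isLastCol`, `isDoubler`, `hasCo`, `isCross`, `isUnitK`,
  `isLastClause` and how `mKind` / `cKind` fall into them;
* `RoleAtOK K idx` — the role of local vertex `idx` is of the kind's class, its codes are in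
  range, the INTERFACE roles sit at the agreed boundary points (`(0,14)`, `(72,14)`, `(0,20)`,
  `(0,28)`, `(72,20)`, `(72,28)`, `(40,0)`, `(46,0)`, `(40,h)`, `(46,h)`, `(34+i, 0)`,
  `(72 r + 34 + i, 8)`), and a vertex on the boundary carries an interface role of that side;
* `Kind.roles_nodup` — no role twice in a kind;
* **`Kind.allOK`** (by `decide`) and the unpacking lemmas `Kind.roleAtOK`, ….

## References

* M. Liśkiewicz, M. Ogihara, S. Toda, TCS 304 (2003) 129–156, §4 (proof of Theorem 7, `E₀`).
-/

namespace Literature.Barriers.CriticalPhenomena.GridSAW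

namespace FormulaTiles

open Literature.Computability.Complexity (CNF)
open Literature.Combinatorics.SimpleGraph Literature.Combinatorics.SimpleGraph.GridFormula
open Literature.Combinatorics.SimpleGraph.GridFormula.Slot

/-! ### Classifiers -/

namespace Kind

/-- Kinds of the first column (no row chord from the west). [folklore] -/
def isFirstCol : Kind → Bool
  | .emptyFirst | .tapFirst | .crossFirst | .tapDoubler | .tapDoublerLast => true
  | _ => false

/-- Kinds of the last column (no row chord to the east; the exit corner on the east side). [folklore] -/
def isLastCol : Kind → Bool
  | .emptyLast | .tapLast | .crossLast | .tapDoublerLast => true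
  | _ => false

/-- The kinds with the doubling cell. [folklore] -/
def isDoubler : Kind → Bool
  | .tapDoubler | .tapDoublerLast => true
  | _ => false

/-- The kinds with a column chord leaving downwards. [folklore] -/
def hasCo : Kind → Bool
  | .tapFirst | .tapMid | .tapLast | .crossFirst | .crossMid | .crossLast | .tapDoubler | .tapDoublerLast => true
  | _ => false

/-- The crossing kinds (a column chord entering from above). [folklore] -/
def isCross : Kind → Bool
  | .crossFirst | .crossMid | .crossLast => true
  | _ => false

/-- Clause kinds of a one-literal clause. [folklore] -/
def isUnitK : Kind → Bool
  | .clauseBn3Or1Notlast | .clauseBn3Or1Last | .clauseBn0Or1Notlast | .clauseBn0Or1Last => true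
  | _ => false

/-- Clause kinds of the last column. [folklore] -/
def isLastClause : Kind → Bool
  | .clauseBn3Or1Last | .clauseBn3Or3Last | .clauseBn0Or1Last | .clauseBn0Or3Last => true
  | _ => false

/-- Clause kinds landing on the top slot `bN3`. [folklore] -/
def isBn3 : Kind → Bool
  | .clauseBn3Or1Notlast | .clauseBn3Or1Last | .clauseBn3Or3Notlast | .clauseBn3Or3Last => true
  | _ => false

/-! ### The finite facts, as one decidable predicate -/

/-- The position of local vertex `idx`. [folklore] -/
def posAt (K : Kind) (idx : ℕ) : GridPoint := K.tile.pos.getD idx (0, 0)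

/-- **The facts about the role and the position of local vertex `idx` of kind `K`.** [folklore] -/
def RoleAtOK (K : Kind) (idx : ℕ) : Bool :=
  let p := K.posAt idx
  (match K.role idx with
    | .cell c b => K.isMatrix && decide (c ≤ 2) && decide (b < 16) &&
        (!(K.isLastCol && decide (c = 2) && decide (b = 3)) || decide (p = (72, 26)))
    | .conn c => K.isMatrix &&
        ((decide (c ≤ 2) && (decide (c ≠ 0) || K.isDoubler || decide (p = (0, 14)))) ||
          (decide (c = 3) && !K.isLastCol && decide (p = (72, 14))))
    | .gad r code => K.isMatrix &&
        ((decide (1 ≤ r) && decide (r ≤ 4) && decide (code < 12)) ||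
          (decide (r = 0) && !K.isFirstCol && ((decide (code = 4) && decide (p = (0, 20))) || (decide (code = 7) && decide (p = (0, 28))))) ||
          (decide (r = 5) && K.isCross && ((decide (code = 4) && decide (p = (40, 54))) || (decide (code = 7) && decide (p = (46, 54))))))
    | .gadNext0 code => K.isMatrix && !K.isLastCol && decide (code < 12) &&
        (decide (code ≠ 4) || decide (p = (72, 20))) && (decide (code ≠ 7) || decide (p = (72, 28)))
    | .gadCo code => K.isMatrix && K.hasCo && decide (code < 12) &&
        (decide (code ≠ 4) || decide (p = (40, 0))) && (decide (code ≠ 7) || decide (p = (46, 0)))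
    | .dcell b => K.isDoubler && decide (b < 12)
    | .s => K.isDoubler
    | .bead b => K.isClause && decide (b < 12)
    | .bconn => K.isClause && decide (p = (0, 14))
    | .bconnN => K.isClause && !K.isLastClause && decide (p = (72, 14))
    | .land code => K.isClause && ((decide (code = 4) && decide (p = (40, 40))) || (decide (code = 7) && decide (p = (46, 40))))
    | .orr i => K.isClause && decide (i < 6) && (!K.isUnitK || decide (i < 2)) &&
        (K.isUnitK || !(decide (i = 0) || decide (i = 2) || decide (i = 3) || decide (i = 4)) || decide (p = (((34 + i : ℕ) : ℤ), (0 : ℤ))))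
    | .orm => K.isClause
    | .or code => decide (K = .rung3) && decide (code < 27) &&
        (decide (18 ≤ code) || ((decide (code % 6 = 0) || decide (code % 6 = 2) || decide (code % 6 = 3) || decide (code % 6 = 4)) &&
          decide (p = (((72 * (code / 6) + 34 + code % 6 : ℕ) : ℤ), (8 : ℤ))))) &&
        (decide (code < 18) || decide (21 ≤ code))) &&
  -- a boundary vertex carries an interface role of its side
  (decide (p.1 ≠ 0) || (match K.role idx with
    | .conn 0 => !K.isDoubler | .gad 0 _ => true | .bconn => true | _ => false)) &&
  (decide (p.1 ≠ K.tile.w) || (match K.role idx with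
    | .conn 3 => true | .gadNext0 4 => true | .gadNext0 7 => true | .cell 2 3 => K.isLastCol | .bconnN => true | _ => false)) &&
  (decide (p.2 ≠ 0) || (match K.role idx with
    | .gadCo 4 => true | .gadCo 7 => true
    | .orr i => !K.isUnitK && (decide (i = 0) || decide (i = 2) || decide (i = 3) || decide (i = 4))
    | _ => false)) &&
  (decide (p.2 ≠ K.tile.h) || (match K.role idx with
    | .gad 5 _ => true | .land _ => true | .or code => decide (code < 18) | _ => false))

/-- **All the facts about a kind**: roles without repetition, and `RoleAtOK` at every vertex. [folklore] -/
def AllOK (K : Kind) : Bool :=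
  K.roles.Nodup && (List.range K.tile.nv).all (RoleAtOK K)

set_option maxRecDepth 100000 in
/-- **The facts hold for all twenty kinds** (kernel computation on the tile literals). [folklore] -/
theorem allOK : ∀ K : Kind, K.AllOK = true := by
  intro K; cases K <;> decide +kernel

/-- No role twice in a kind. [folklore] -/
theorem roles_nodup (K : Kind) : K.roles.Nodup := by
  have h := allOK K
  unfold AllOK at h
  simp only [Bool.and_eq_true, decide_eq_true_eq] at h
  exact h.1

/-- The facts at a local vertex. [folklore] -/
theorem roleAtOK (K : Kind) {idx : ℕ} (hidx : idx < K.tile.nv) : K.RoleAtOK idx = true := by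
  have h := allOK K
  unfold AllOK at h
  simp only [Bool.and_eq_true, List.all_eq_true, List.mem_range] at h
  exact h.2 idx hidx

/-- The role of a vertex is the listed role. [folklore] -/
theorem role_eq_getElem (K : Kind) {idx : ℕ} (hidx : idx < K.tile.nv) :
    K.role idx = K.roles[idx]'(by rw [K.roles_length]; exact hidx) := by
  unfold role
  rw [List.getD_eq_getElem]

/-- The position of a vertex is the listed position. [folklore] -/
theorem posAt_eq_getElem (K : Kind) {idx : ℕ} (hidx : idx < K.tile.nv) : K.posAt idx = K.tile.pos[idx] := by
  unfold posAt
  rw [List.getD_eq_getElem]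

/-- **Equal roles at two vertices of a kind force equal vertices.** [folklore] -/
theorem idx_eq_of_role_eq (K : Kind) {i i' : ℕ} (hi : i < K.tile.nv) (hi' : i' < K.tile.nv) (h : K.role i = K.role i') : i = i' := by
  rw [K.role_eq_getElem hi, K.role_eq_getElem hi'] at h
  exact (List.Nodup.getElem_inj_iff K.roles_nodup).1 h

/-! ### The roles present in a kind -/

/-- The local vertices of a cell type, as numbers. [folklore] -/
def cellVertsN (cross : Bool) (_c : ℕ) : List ℕ :=
  if cross then List.range 16 else List.range 12

/-- **The roles a kind must list** (its cells, connectors, the gadgets whose boxes it draws, the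
interface nodes it draws lanes to, the doubling cell; the terminal, its connector(s), the landing
nodes and this column's OR-rail; the rung tile's shared rail nodes and cross-rung midpoints). [folklore] -/
def expectedRoles (K : Kind) : List TileRole :=
  if K.isMatrix then
    ((List.range 3).flatMap fun c => (cellVertsN K.isCross c).map fun b => TileRole.cell c b) ++
    [.conn 0, .conn 1, .conn 2] ++ (if K.isLastCol then [] else [.conn 3]) ++
    ((if K.isCross then [1, 2, 3, 4] else [1, 2]).flatMap fun r => (List.range 12).map fun code => TileRole.gad r code) ++
    (if K.isLastCol then [] else (List.range 12).map fun code => TileRole.gadNext0 code) ++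
    (if K.hasCo then (List.range 12).map fun code => TileRole.gadCo code else []) ++
    (if K.isFirstCol then [] else [.gad 0 4, .gad 0 7]) ++
    (if K.isCross then [.gad 5 4, .gad 5 7] else []) ++
    (if K.isDoubler then (List.range 12).map (fun b => TileRole.dcell b) ++ [.s] else [])
  else if K.isClause then
    ((List.range 12).map fun b => TileRole.bead b) ++ [.bconn] ++ (if K.isLastClause then [] else [.bconnN]) ++
    [.land 4, .land 7] ++
    (if K.isUnitK then [.orr 0, .orr 1, .orm] else [.orr 0, .orr 1, .orr 2, .orr 3, .orr 4, .orr 5, .orm])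
  else
    ([0, 2, 3, 4, 6, 8, 9, 10, 12, 14, 15, 16] ++ [21, 22, 23, 24, 25, 26]).map fun code => TileRole.or code

/-- **A kind lists exactly the expected roles.** [folklore] -/
def PresentOK (K : Kind) : Bool :=
  (expectedRoles K).all (fun ρ => decide (ρ ∈ K.roles)) && K.roles.all (fun ρ => decide (ρ ∈ expectedRoles K))

set_option maxRecDepth 100000 in
/-- The kinds list exactly the expected roles (kernel computation). [folklore] -/
theorem presentOK : ∀ K : Kind, K.PresentOK = true := by
  intro K; cases K <;> decide +kernel

/-- **Membership in the roles of a kind is membership in the expected roles.** [folklore] -/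
theorem mem_roles_iff (K : Kind) {ρ : TileRole} : ρ ∈ K.roles ↔ ρ ∈ expectedRoles K := by
  have h := presentOK K
  unfold PresentOK at h
  simp only [Bool.and_eq_true, List.all_eq_true, decide_eq_true_eq] at h
  exact ⟨fun hρ => h.2 ρ hρ, fun hρ => h.1 ρ hρ⟩

/-- A listed role is the role of some local vertex. [folklore] -/
theorem exists_idx_of_mem_roles (K : Kind) {ρ : TileRole} (h : ρ ∈ K.roles) : ∃ idx < K.tile.nv, K.role idx = ρ := by
  obtain ⟨idx, hidx, rfl⟩ := List.getElem_of_mem h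
  rw [K.roles_length] at hidx
  exact ⟨idx, hidx, (K.role_eq_getElem hidx)⟩

/-- The role of a local vertex is listed. [folklore] -/
theorem role_mem_roles (K : Kind) {idx : ℕ} (hidx : idx < K.tile.nv) : K.role idx ∈ K.roles := by
  rw [K.role_eq_getElem hidx]; exact List.getElem_mem _

end Kind

/-! ### The classes of the kinds of the layout -/

variable (ψ : CNF ℕ)

/-- The matrix kind at `(i, j)` is a doubler kind iff `(i, j) = (0, 0)`. [folklore] -/
theorem mKind_isDoubler (i j : ℕ) : (mKind ψ i j).isDoubler = decide (i = 0 ∧ j = 0) := by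
  unfold mKind
  by_cases h : i = 0 ∧ j = 0
  · rw [if_pos h, decide_eq_true h]; split_ifs <;> rfl
  · rw [if_neg h, decide_eq_false h]
    cases tileTy ψ i j <;> cases colPos ψ j <;> rfl

/-- The matrix kind at `(i, j)` is a last-column kind iff `j + 1 = N`. [folklore] -/
theorem mKind_isLastCol (i j : ℕ) : (mKind ψ i j).isLastCol = decide (j + 1 = N ψ) := by
  unfold mKind colPos
  by_cases h : i = 0 ∧ j = 0
  · rw [if_pos h]
    obtain ⟨rfl, rfl⟩ := h
    by_cases hN : N ψ = 1
    · rw [if_pos hN]; simp [Kind.isLastCol, hN]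
    · rw [if_neg hN]; simp [Kind.isLastCol]; omega
  · rw [if_neg h]
    by_cases hl : j + 1 = N ψ
    · rw [if_pos hl, decide_eq_true hl]; cases tileTy ψ i j <;> rfl
    · rw [if_neg hl, decide_eq_false hl]
      split_ifs <;> cases tileTy ψ i j <;> rfl

/-- The matrix kind at `(i, j)` is a first-column kind iff `j = 0` (for `N ≥ 2`, or at `(0,0)`). [folklore] -/
theorem mKind_isFirstCol (i j : ℕ) (hN : j + 1 < N ψ ∨ (i = 0 ∧ j = 0)) : (mKind ψ i j).isFirstCol = decide (j = 0) := by
  unfold mKind colPos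
  by_cases h : i = 0 ∧ j = 0
  · rw [if_pos h]; obtain ⟨rfl, rfl⟩ := h; split_ifs <;> rfl
  · rw [if_neg h]
    have hl : ¬ j + 1 = N ψ := by omega
    rw [if_neg hl]
    by_cases hj : j = 0
    · rw [if_pos hj, decide_eq_true hj]; cases tileTy ψ i j <;> rfl
    · rw [if_neg hj, decide_eq_false hj]; cases tileTy ψ i j <;> rfl

/-- The matrix kind at `(i, j)` is a crossing kind iff the tile is a crossing and `(i, j) ≠ (0, 0)`. [folklore] -/
theorem mKind_isCross (i j : ℕ) (h00 : ¬ (i = 0 ∧ j = 0)) : (mKind ψ i j).isCross = decide (tileTy ψ i j = .cross) := by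
  unfold mKind
  rw [if_neg h00]
  cases tileTy ψ i j <;> cases colPos ψ j <;> rfl

/-- The matrix kind at `(i, j) ≠ (0,0)` has a column chord leaving iff the tile is a tap or a crossing. [folklore] -/
theorem mKind_hasCo (i j : ℕ) (h00 : ¬ (i = 0 ∧ j = 0)) : (mKind ψ i j).hasCo = !decide (tileTy ψ i j = .empty) := by
  unfold mKind
  rw [if_neg h00]
  cases tileTy ψ i j <;> cases colPos ψ j <;> rfl

/-- The doubler kinds have a column chord leaving. [folklore] -/
theorem mKind_hasCo_zero : (mKind ψ 0 0).hasCo = true := by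
  unfold mKind; rw [if_pos ⟨rfl, rfl⟩]; split_ifs <;> rfl

/-- The clause kind of column `j` is a unit kind iff the clause of `j` has one literal. [folklore] -/
theorem cKind_isUnitK (j : ℕ) : (cKind ψ j).isUnitK = isUnitCol ψ j := by
  unfold cKind; split_ifs <;> simp_all [Kind.isUnitK]

/-- The clause kind of column `j` is a last kind iff `j + 1 = N`. [folklore] -/
theorem cKind_isLastClause (j : ℕ) : (cKind ψ j).isLastClause = decide (j + 1 = N ψ) := by
  unfold cKind
  by_cases h : j + 1 = N ψ
  · rw [decide_eq_true h]; simp only [h, ↓reduceIte]; split_ifs <;> rfl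
  · rw [decide_eq_false h]; simp only [h, ↓reduceIte]; split_ifs <;> rfl

/-- The clause kind of column `j` lands on `bN3` iff `landSlot j = bN3`. [folklore] -/
theorem cKind_isBn3 (j : ℕ) : (cKind ψ j).isBn3 = decide (landSlot ψ j = bN3) := by
  unfold cKind
  by_cases h : landSlot ψ j = bN3
  · rw [if_pos h, decide_eq_true h]; split_ifs <;> rfl
  · rw [if_neg h, decide_eq_false h]; split_ifs <;> rfl

/-! ### The edges a kind must draw -/

namespace Kind

/-- The cell type of cell `c` of a matrix kind. [folklore] -/
def cellTyK (K : Kind) (c : ℕ) : GridCell.CellTy := if K.isCross then (if c = 1 then .pct else .pc) else .bead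

/-- **The slots used at cell `c` of a matrix kind** (its own gadgets', the row chords', the
column chords'). [folklore] -/
def kslots (K : Kind) (c : ℕ) : List (Fin 16 × Fin 16) :=
  if K.isCross then
    (if c = 0 then [pS2, pS0, pN8, pN4] ++ (if K.isFirstCol then [] else [pN0])
     else if c = 1 then [tS0, tS4r, tN2r, tS8]
     else [pN0, pN4] ++ (if K.isLastCol then [] else [pN8]))
  else
    (if c = 0 then [bN6] ++ (if K.isFirstCol then [] else [bN3])
     else if c = 1 then [bN3, bN6] ++ (if K.hasCo then [bS1] else [])
     else [bN3] ++ (if K.isLastCol then [] else [bN6]))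

/-- The cell edges of cell `c` that are not slots, as role pairs. [folklore] -/
def cellPairs (K : Kind) (c : ℕ) : List (TileRole × TileRole) :=
  (((K.cellTyK c).edgeList.filter fun ab => decide (ab ∉ K.kslots c ∧ (ab.2, ab.1) ∉ K.kslots c))).map
    fun ab => (TileRole.cell c ab.1.val, TileRole.cell c ab.2.val)

/-- The port edges of an XOR-chord with roles `X`: rail `0` on slot `e₁` of cell `c₁`, rail `1` on
slot `e₂` of cell `c₂` (each rail optional). [folklore] -/
def xorPorts (X : ℕ → TileRole) (rail0 : Bool) (c₁ : ℕ) (e₁ : Fin 16 × Fin 16) (rail1 : Bool) (c₂ : ℕ) (e₂ : Fin 16 × Fin 16) :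
    List (TileRole × TileRole) :=
  (if rail0 then [(TileRole.cell c₁ e₁.1.val, X 0), (X 3, TileRole.cell c₁ e₁.2.val)] else []) ++
    (if rail1 then [(TileRole.cell c₂ e₂.1.val, X 4), (X 7, TileRole.cell c₂ e₂.2.val)] else [])

/-- The codes of the inner edges of an XOR-chord: the two rails and the four rungs. [folklore] -/
def xorInnerCodes : List (ℕ × ℕ) :=
  ((List.range 2).flatMap fun r => (List.range 3).map fun i => (4 * r + i, 4 * r + i + 1)) ++
    ((List.range 4).flatMap fun i => [(8 + i, i), (8 + i, 4 + i)])

/-- The inner edges of an XOR-chord with roles `X`. [folklore] -/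
def xorInner (X : ℕ → TileRole) : List (TileRole × TileRole) := xorInnerCodes.map fun p => (X p.1, X p.2)

/-- **The role pairs a kind must join by a drawn edge.** [folklore] -/
def expectedEdges (K : Kind) : List (TileRole × TileRole) :=
  if K.isMatrix then
    K.cellPairs 0 ++ K.cellPairs 1 ++ K.cellPairs 2 ++
    -- the chain through the connectors
    ((List.range 3).flatMap fun c => [(TileRole.conn c, TileRole.cell c (K.cellTyK c).pIdx.val),
      (TileRole.cell c (K.cellTyK c).qIdx.val, TileRole.conn (c + 1))]).filter
      (fun p => !(K.isLastCol && decide (p.2 = TileRole.conn 3))) ++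
    -- the tile's own chords
    (if K.isCross then
      xorPorts (TileRole.gad 1) true 0 pS2 true 1 tS0 ++ xorInner (TileRole.gad 1) ++
      xorPorts (TileRole.gad 2) true 0 pS0 true 1 tS4r ++ xorInner (TileRole.gad 2) ++
      xorPorts (TileRole.gad 3) true 1 tN2r true 2 pN0 ++ xorInner (TileRole.gad 3) ++
      xorPorts (TileRole.gad 4) true 0 pN8 true 2 pN4 ++ xorInner (TileRole.gad 4)
     else
      xorPorts (TileRole.gad 1) true 0 bN6 true 1 bN3 ++ xorInner (TileRole.gad 1) ++
      xorPorts (TileRole.gad 2) true 1 bN6 true 2 bN3 ++ xorInner (TileRole.gad 2)) ++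
    -- the row chord entering (rail-1 ports only) and leaving (all but rail-1 ports)
    (if K.isFirstCol then [] else xorPorts (TileRole.gad 0) false 0 pN0 true 0 (if K.isCross then pN0 else bN3)) ++
    (if K.isLastCol then [] else xorPorts TileRole.gadNext0 true 2 (if K.isCross then pN8 else bN6) false 0 pN0 ++ xorInner TileRole.gadNext0) ++
    -- the column chord entering (crossing kinds) and leaving
    (if K.isCross then xorPorts (TileRole.gad 5) false 0 pN4 true 0 pN4 else []) ++
    (if K.hasCo then xorPorts TileRole.gadCo true 1 (if K.isCross then tS8 else bS1) false 0 pN4 ++ xorInner TileRole.gadCo else []) ++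
    -- the doubling cell
    (if K.isDoubler then (GridCell.CellTy.bead.edgeList.map fun ab => (TileRole.dcell ab.1.val, TileRole.dcell ab.2.val)) ++
      [(TileRole.s, TileRole.dcell 0), (TileRole.dcell 3, TileRole.conn 0)] else [])
  else if K.isClause then
    let ls : Fin 16 × Fin 16 := if K.isBn3 then bN3 else bN0
    ((GridCell.CellTy.bead.edgeList.filter fun ab => decide (ab ∉ [bS0, ls] ∧ (ab.2, ab.1) ∉ [bS0, ls])).map
      fun ab => (TileRole.bead ab.1.val, TileRole.bead ab.2.val)) ++
    [(TileRole.bconn, TileRole.bead 0)] ++ (if K.isLastClause then [] else [(TileRole.bead 3, TileRole.bconnN)]) ++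
    [(TileRole.land 4, TileRole.bead ls.1.val), (TileRole.land 7, TileRole.bead ls.2.val)] ++
    (if K.isUnitK then
      [(TileRole.bead 0, TileRole.orr 0), (.orr 0, .orr 1), (.orr 1, TileRole.bead 1), (.orm, .orr 0), (.orm, .orr 1)]
     else
      [(TileRole.bead 0, TileRole.orr 0)] ++ ((List.range 5).map fun i => (TileRole.orr i, TileRole.orr (i + 1))) ++
      [(TileRole.orr 5, TileRole.bead 1), (.orm, .orr 1), (.orm, .orr 5)])
  else
    (List.range 6).flatMap fun t =>
      [(TileRole.or (18 + (t + 3)), TileRole.or (GridFormulaFP.or3FstC (t + 3))),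
       (TileRole.or (18 + (t + 3)), TileRole.or (GridFormulaFP.or3SndC (t + 3)))]

/-- The role pairs joined by the drawn edges of a kind. [folklore] -/
def rolePairs (K : Kind) : List (TileRole × TileRole) := K.tile.edges.map fun e => (K.role e.1, K.role e.2.1)

/-- **A kind draws all its expected edges** (in some orientation). [folklore] -/
def EdgesOK (K : Kind) : Bool :=
  (expectedEdges K).all fun p => decide (p ∈ K.rolePairs) || decide ((p.2, p.1) ∈ K.rolePairs)

set_option maxRecDepth 100000 in
/-- The kinds draw all their expected edges (kernel computation). [folklore] -/
theorem edgesOK : ∀ K : Kind, K.EdgesOK = true := by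
  intro K; cases K <;> decide +kernel

/-- **An expected role pair is joined by a drawn edge.** [folklore] -/
theorem exists_edge_of_expected (K : Kind) {p : TileRole × TileRole} (h : p ∈ K.expectedEdges) :
    ∃ e ∈ K.tile.edges, (K.role e.1, K.role e.2.1) = p ∨ (K.role e.1, K.role e.2.1) = (p.2, p.1) := by
  have hK := edgesOK K
  unfold EdgesOK at hK
  simp only [List.all_eq_true, Bool.or_eq_true, decide_eq_true_eq] at hK
  rcases hK p h with hp | hp <;> obtain ⟨e, he, hpe⟩ := List.mem_map.1 hp
  · exact ⟨e, he, Or.inl hpe⟩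
  · exact ⟨e, he, Or.inr hpe⟩

end Kind

end FormulaTiles

end Literature.Barriers.CriticalPhenomena.GridSAW
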